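import Literature.Computability.AlgebraicComplexity.TableauPolarization
import Literature.Computability.AlgebraicComplexity.OrbitCoordinateRing
import Mathlib.GroupTheory.Perm.Sign
import HarnessLib

/-!
# The tableau polynomial on `Sym^m` and its evaluation at sums of products of linear forms

Mathematical layer of the Lean checker of the GCT multiplicity-obstruction engine (cell `pub-gct`;
honest framing: rung-1 multiplicity-obstruction search for permanent versus determinant at small
`(n, m)`, no claim about VP ≠ VNP or P ≠ NP), step H1b. A **tableau datum** `τ : TabM σ` records
a Young diagram column by column (`C` columns of heights `h c`), the VARIABLE `var c r : σ` carried
by the alternator of column `c` in row `r`, and — the content being `m^d` — a bijective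
enumeration `box u s` of the `m` boxes of each label `u < d` (Dörfler–Ikenmeyer–Panova 2020 §5;
hwv `FORMAT.md` §2). From it:

* `TabM.EC coef form` — the mathematical twin of the kernel evaluator `TableauEval.evalC`
  (`PlethysmTableauEvaluation.lean`): `∑_{π = (π_c) column bijections} (∏_c sign π_c) ·
  ∏_u symEntryM (word of label u under π)` at a point presented as `∑_t c_t ∏_s ℓ_{t,s}`;
* `TabM.tabPoly` — **the tableau polynomial** `F_τ = ∑_π (∏_c sign π_c) ∏_u α_u(π)! · X_{α_u(π)}`,
  an honest element of the coordinate ring `K[Sym^m (K^σ)] = MvPolynomial (DegIdx σ m) K` of the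
  tree (`OrbitCoordinateRing.lean`), `α_u(π)` = the content of the word of label `u`;
* `TabM.aeval_formCoeff_tabPoly` — **`F_τ(q) = EC(presentation of q)`**: by the polarisation
  identity (`symEntryM_eq`, `TableauPolarization.lean`) the value of `F_τ` at a form `q`
  (`aeval (formCoeff m q)`) is `EC` of ANY sum-of-products presentation of `q`; in particular the
  kernel's evaluation at `g · P` computes `F_τ(g · P)` (once `evalC = EC` is bridged, file H1d).

No highest-weight property is claimed here (that is H1c, `TableauHighestWeight.lean`).
Elementary [folklore] around [DorflerIkenmeyerPanova2020, §5].
-/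

noncomputable section

open scoped BigOperators

namespace Literature.Computability.AlgebraicComplexity

namespace TableauEval

open MvPolynomial

variable {σ : Type*} {K : Type*} [CommRing K]

/-! ## §1 Tableau data -/

/-- A labelled Young diagram by columns with alternator variables in `σ`: `C` columns of heights
`h`, `d` labels each on `m` boxes enumerated by `box` (label `u`, index `s` ↦ a box
`⟨column, row⟩`), and `var c r` the variable the alternator of column `c` uses in row `r`.
Well-formedness (bijectivity of `box`, distinctness of `var c ·`) is not part of the structure;
the theorems that need it say so. [folklore] -/
structure TabM (σ : Type*) where
  /-- number of columns -/
  C : ℕ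
  /-- number of labels (outer degree `d`) -/
  d : ℕ
  /-- boxes per label (inner degree `m`) -/
  m : ℕ
  /-- column heights -/
  h : Fin C → ℕ
  /-- alternator variable of column `c`, row `r` -/
  var : (c : Fin C) → Fin (h c) → σ
  /-- the `s`-th box carrying label `u` -/
  box : Fin d → Fin m → (c : Fin C) × Fin (h c)

namespace TabM

variable (τ : TabM σ)

/-- A tuple of column bijections `π = (π_c)_c`, `π_c ∈ 𝔖_{h c}` (row `r` of column `c` receives
the alternator variable `var c (π_c r)`). [folklore] -/
abbrev Bij : Type := (c : Fin τ.C) → Equiv.Perm (Fin (τ.h c))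

/-- The product of the signs of the column bijections. [folklore] -/
def sgnProd (π : τ.Bij) : ℤˣ := ∏ c, Equiv.Perm.sign (π c)

/-- The word of label `u` under `π`: position `s` ↦ the variable given to the `s`-th box of `u`.
[folklore] -/
def word (π : τ.Bij) (u : Fin τ.d) : Fin τ.m → σ :=
  fun s => τ.var (τ.box u s).1 (π (τ.box u s).1 (τ.box u s).2)

/-- The content `α_u(π)` of the word of label `u`. [folklore] -/
def content (π : τ.Bij) (u : Fin τ.d) : σ →₀ ℕ := wordContent (τ.word π u)

/-- The content of an `m`-letter word has degree `m`. [folklore] -/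
theorem degree_wordContent {m : ℕ} (w : Fin m → σ) : (wordContent w).degree = m := by
  rw [wordContent, map_sum]
  simp [Finsupp.degree_single]

variable [Fintype σ] [DecidableEq σ]

/-- `α_u(π)` is a degree-`m` monomial index. [folklore] -/
theorem content_mem (π : τ.Bij) (u : Fin τ.d) : τ.content π u ∈ degMonomials σ τ.m := by
  rw [mem_degMonomials_iff, content, degree_wordContent]

/-- `α_u(π)` as a coordinate index of `Sym^m`. [folklore] -/
def contentIdx (π : τ.Bij) (u : Fin τ.d) : DegIdx σ τ.m := ⟨τ.content π u, τ.content_mem π u⟩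

/-! ## §2 The mathematical evaluator and the tableau polynomial -/

/-- **Mathematical column-bijection evaluation** at a sum of `T` products of `m` linear forms
(`coef`, `form`): `∑_π (∏_c sign π_c) ∏_u symEntryM (word_u π)` — the twin of
`TableauEval.evalC`. [folklore] -/
def EC {T : ℕ} (coef : Fin T → K) (form : Fin T → Fin τ.m → σ → K) : K :=
  ∑ π : τ.Bij, ((τ.sgnProd π : ℤ) : K) * ∏ u, symEntryM coef form (τ.word π u)

variable (K) in
/-- **The tableau polynomial** `F_τ = ∑_π (∏_c sign π_c) · ∏_u α_u(π)! X_{α_u(π)}`, a polynomial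
function on `Sym^m (K^σ)` (hwv `FORMAT.md` §2: `F̂_T(q) = ∑_σ [∏ sgn σ_c] ∏_u q̂(α_u(σ))`,
`q̂(α) = α! c_α`). [folklore] -/
def tabPoly : MvPolynomial (DegIdx σ τ.m) K :=
  ∑ π : τ.Bij, ((τ.sgnProd π : ℤ) : K) •
    ∏ u, ((ffact (τ.content π u) : K) • X (τ.contentIdx π u))

/-- **`F_τ(q) = EC(presentation of q)`**: the value of the tableau polynomial at the form
`q = ∑_t c_t ∏_s ℓ_{t,s}` is the mathematical evaluator at that presentation (polarisation
identity `symEntryM_eq`). In particular the value does not depend on the presentation.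
[folklore] -/
theorem aeval_formCoeff_tabPoly {T : ℕ} (coef : Fin T → K) (form : Fin T → Fin τ.m → σ → K) :
    aeval (formCoeff τ.m (splfPoly coef form)) (τ.tabPoly K) = τ.EC coef form := by
  unfold tabPoly EC
  rw [map_sum]
  refine Finset.sum_congr rfl fun π _ => ?_
  rw [map_smul, map_prod, smul_eq_mul]
  congr 1
  refine Finset.prod_congr rfl fun u _ => ?_
  rw [map_smul, aeval_X, formCoeff_apply, smul_eq_mul, symEntryM_eq]
  rfl

/-- Presentation independence of the mathematical evaluator. [folklore] -/
theorem EC_congr_form {T T' : ℕ} {coef : Fin T → K} {form : Fin T → Fin τ.m → σ → K}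
    {coef' : Fin T' → K} {form' : Fin T' → Fin τ.m → σ → K}
    (hq : splfPoly coef form = splfPoly coef' form') : τ.EC coef form = τ.EC coef' form' := by
  rw [← aeval_formCoeff_tabPoly, ← aeval_formCoeff_tabPoly, hq]

end TabM

end TableauEval

end Literature.Computability.AlgebraicComplexity

end
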